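import Summits.ABC.ABC.Theses.IneffectiveSubspace

/-!
# `TowerLiouvilleExponent` (stmt-ABC-1650): the trivial ("Liouville") end of the exponent dial

Route `IneffectiveSubspace` (ABC/ABC) types the arithmetic shadow of Vojta's conjecture on the
hypersurfaces `X_n ⊂ (ℙ²)ⁿ` of [Vojta2000ABC, §3] as a family `TowerIneq(n, A)`:
`z₁z₂²⋯zₙⁿ < C(n, ε) · (∏ᵢ xᵢyᵢzᵢ)^(A + ε)` on positive solutions of
`x₁x₂²⋯xₙⁿ + y₁y₂²⋯yₙⁿ = z₁z₂²⋯zₙⁿ` with `gcd(∏ xᵢⁱ, ∏ yᵢⁱ) = 1`.  This file proves the calibration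
item `TowerLiouvilleExponent`: `TowerIneq(n, n/2)` holds for every level `n ≥ 1`, with the constant `C = 2`
(coprimality is not even used).

**Proof.**  Write `a = ∏ xᵢ^(i+1)`, `b = ∏ yᵢ^(i+1)`, `c = ∏ zᵢ^(i+1)`, `P = ∏ xᵢyᵢzᵢ` (all in `ℕ`).
* `a, b ≥ 1` and `a + b = c` give `c = a + b ≤ ab + ab = 2ab`, hence `c² ≤ 2abc`.
* Every exponent `i + 1 ≤ n` and every base is `≥ 1`, so `a ≤ (∏ xᵢ)ⁿ`, `b ≤ (∏ yᵢ)ⁿ`, `c ≤ (∏ zᵢ)ⁿ`,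
  whence `abc ≤ Pⁿ` and `c² ≤ 2Pⁿ`.
* Over `ℝ`, with `Q = P^(n/2)` (`Q² = Pⁿ`, `Q > 0`): `c² ≤ 2Q²` forces `c < 2Q`, and `P ≥ 1` gives
  `Q ≤ P^(n/2 + ε)`; so `c < 2 · P^(n/2 + ε)`.

Sources: the route file's docstring for item stmt-ABC-1650 (planner), [Vojta2000ABC, §3] for the objects.
Uses only Mathlib.  Deliberately NOT here: any exponent below `n/2` (items `TowerFourSubLiouville`,
`TowerExponentWindow` of the same route).
-/

-- `Summit.<Summit>.<Problem>` is the mandated summit-side namespace (CONVENTIONS §2); for the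
-- single-conjunct summit `ABC` the two coincide, so the duplicate `ABC.ABC` is deliberate.
set_option linter.dupNamespace false

namespace Summit.ABC.ABC.Theorems

/-- For a tuple `x : Fin n → ℕ` of positive integers, the "tower" product `∏ᵢ xᵢ^(i+1)` is at most
`(∏ᵢ xᵢ)ⁿ`, because each exponent `i + 1` is `≤ n` and each base is `≥ 1`. [folklore] -/
theorem TowerLiouvilleExponent.prod_pow_succ_le_prod_pow {n : ℕ} (x : Fin n → ℕ)
    (hx : ∀ i, 0 < x i) : (∏ i, x i ^ (i.val + 1)) ≤ (∏ i, x i) ^ n := by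
  rw [← Finset.prod_pow]
  exact Finset.prod_le_prod' fun i _ => Nat.pow_le_pow_right (hx i) i.isLt

/-- The tower product of a tuple of positive integers is positive. [folklore] -/
theorem TowerLiouvilleExponent.prod_pow_succ_pos {n : ℕ} (x : Fin n → ℕ) (hx : ∀ i, 0 < x i) :
    0 < ∏ i, x i ^ (i.val + 1) :=
  Finset.prod_pos fun i _ => pow_pos (hx i) _

/-- **`TowerLiouvilleExponent` (stmt-ABC-1650).**  The Liouville-trivial exponent `n/2` of the tower
inequality: for every `n ≥ 1` and `ε > 0`, with `C = 2`, every positive solution of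
`∏ xᵢ^(i+1) + ∏ yᵢ^(i+1) = ∏ zᵢ^(i+1)` (coprimality is part of the statement but unused) satisfies
`∏ zᵢ^(i+1) < 2 · (∏ xᵢyᵢzᵢ)^(n/2 + ε)`.  Proof: `c² ≤ 2abc ≤ 2(∏ xᵢyᵢzᵢ)ⁿ`, then take square roots
and absorb `ε` using `∏ xᵢyᵢzᵢ ≥ 1`.  Calibration item of route `IneffectiveSubspace`
[cite: Vojta2000ABC, §3]. -/
theorem towerLiouvilleExponent_proof :
    Summit.ABC.ABC.Theses.IneffectiveSubspace.TowerLiouvilleExponent := by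
  unfold Summit.ABC.ABC.Theses.IneffectiveSubspace.TowerLiouvilleExponent
  intro n _hn ε hε
  refine ⟨2, two_pos, ?_⟩
  intro x y z hpos hsum _hcop
  set a : ℕ := ∏ i, x i ^ (i.val + 1) with ha
  set b : ℕ := ∏ i, y i ^ (i.val + 1) with hb
  set c : ℕ := ∏ i, z i ^ (i.val + 1) with hc
  set P : ℕ := ∏ i, x i * y i * z i with hP
  -- positivity
  have ha1 : 1 ≤ a := TowerLiouvilleExponent.prod_pow_succ_pos x fun i => (hpos i).1
  have hb1 : 1 ≤ b := TowerLiouvilleExponent.prod_pow_succ_pos y fun i => (hpos i).2.1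
  have hP1 : 1 ≤ P :=
    Finset.prod_pos fun i _ => Nat.mul_pos (Nat.mul_pos (hpos i).1 (hpos i).2.1) (hpos i).2.2
  -- `c ≤ 2ab`
  have h2ab : c ≤ 2 * (a * b) := by
    rw [← hsum]
    nlinarith [ha1, hb1]
  -- `abc ≤ Pⁿ`
  have haP : a ≤ (∏ i, x i) ^ n :=
    TowerLiouvilleExponent.prod_pow_succ_le_prod_pow x fun i => (hpos i).1
  have hbP : b ≤ (∏ i, y i) ^ n :=
    TowerLiouvilleExponent.prod_pow_succ_le_prod_pow y fun i => (hpos i).2.1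
  have hcP : c ≤ (∏ i, z i) ^ n :=
    TowerLiouvilleExponent.prod_pow_succ_le_prod_pow z fun i => (hpos i).2.2
  have hPsplit : P ^ n = (∏ i, x i) ^ n * (∏ i, y i) ^ n * (∏ i, z i) ^ n := by
    simp only [hP, Finset.prod_mul_distrib, mul_pow]
  have habc : a * b * c ≤ P ^ n := by
    rw [hPsplit]
    exact Nat.mul_le_mul (Nat.mul_le_mul haP hbP) hcP
  -- `c² ≤ 2 Pⁿ`
  have hc2 : c * c ≤ 2 * P ^ n :=
    calc c * c ≤ 2 * (a * b) * c := Nat.mul_le_mul_right c h2ab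
      _ = 2 * (a * b * c) := by ring
      _ ≤ 2 * P ^ n := Nat.mul_le_mul_left 2 habc
  -- move to `ℝ`
  have hc2R : (c : ℝ) * c ≤ 2 * (P : ℝ) ^ n := by exact_mod_cast hc2
  have hP1R : (1 : ℝ) ≤ P := by exact_mod_cast hP1
  have hPposR : (0 : ℝ) < P := by linarith
  set Q : ℝ := (P : ℝ) ^ ((n : ℝ) / 2) with hQ
  have hQpos : 0 < Q := Real.rpow_pos_of_pos hPposR _
  have hQsq : Q * Q = (P : ℝ) ^ n := by
    rw [hQ, ← Real.rpow_add hPposR, add_halves, Real.rpow_natCast]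
  have hc2Q : (c : ℝ) * c ≤ 2 * (Q * Q) := by
    rw [hQsq]
    exact hc2R
  have hclt : (c : ℝ) < 2 * Q := by
    nlinarith [hQpos, hc2Q, mul_pos hQpos hQpos]
  have hQle : Q ≤ (P : ℝ) ^ ((n : ℝ) / 2 + ε) :=
    Real.rpow_le_rpow_of_exponent_le hP1R (by linarith)
  calc (c : ℝ) < 2 * Q := hclt
    _ ≤ 2 * (P : ℝ) ^ ((n : ℝ) / 2 + ε) := by linarith

end Summit.ABC.ABC.Theorems
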